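import Literature.MathematicalPhysics.QuantumFieldTheory.QCDOS

/-!
# Stub `stub_offsetMeetsThreshold` of line `Sketch`
(crux `Summit.QuantumFields.QCD.Theses.HeatSlicedQuarks.InterleavedFlowProper`, item stmt-QuantumFields-18031)

**Offset-last meets any block-coupling threshold.**  For `N_f ∈ {2, 3}`, every lattice
Λ-parameter `Λ > 0` and every threshold `β₀` there is an offset `M₀ > 0` such that the two-loop
inverse coupling profile `afBeta N_f Λ ℓ` is at least `β₀` at every block scale `0 < ℓ ≤ 1/M₀`.
This is the elementary real-analysis fact that makes it legal to choose the flavour-blind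
quark-mass offset `M₀` LAST, after the consumer's block-coupling threshold `β₀`.

Proof.  Put `b₀ = betaCoeff₀ N_f`, `b₁ = betaCoeff₁ N_f`; for `N_f = 2, 3` one has `b₀ > 0` and
`b₁ ≥ 0`.  Let `U := max 1 (β₀ / (2 b₀))` and `M₀ := Λ · exp (U / 2) > 0`.  If `0 < ℓ ≤ 1 / M₀`
then `ℓ Λ exp (U/2) ≤ 1`, so `exp U · ℓ² Λ² ≤ 1`, i.e. `exp U ≤ 1 / (ℓ² Λ²)`, and by monotonicity
of the logarithm `U ≤ u := log (1 / (ℓ² Λ²))`.  Since `u ≥ U ≥ 1`, `log u ≥ 0`, hence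
`afBeta N_f Λ ℓ = 2 b₀ u + 2 (b₁ / b₀) log u ≥ 2 b₀ u ≥ 2 b₀ U ≥ β₀`.
No named facts are used (Mathlib only, plus the definitions `afBeta`, `betaCoeff₀`, `betaCoeff₁`).
-/

namespace Summit.QuantumFields.QCD.Cruxes.InterleavedFlowProper.OffsetLastFormatHandover

open Literature.MathematicalPhysics.QuantumFieldTheory

/-- `b₀ > 0` for two and three flavours (asymptotic freedom, `N_f ≤ 16`). -/
private theorem betaCoeff₀_pos_of_two_or_three {Nf : ℕ} (hNf : Nf = 2 ∨ Nf = 3) :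
    0 < betaCoeff₀ Nf := by
  rcases hNf with rfl | rfl <;> (unfold betaCoeff₀; norm_num; positivity)

/-- `b₁ ≥ 0` for two and three flavours. -/
private theorem betaCoeff₁_nonneg_of_two_or_three {Nf : ℕ} (hNf : Nf = 2 ∨ Nf = 3) :
    0 ≤ betaCoeff₁ Nf := by
  rcases hNf with rfl | rfl <;> (unfold betaCoeff₁; norm_num; positivity)

/-- **Offset-last meets any block-coupling threshold**: for `N_f ∈ {2,3}`, every lattice
Λ-parameter `Λ > 0` and every threshold `β₀` there is an offset `M₀ > 0` such that the two-loop
inverse coupling `afBeta N_f Λ ℓ` is at least `β₀` at every block scale `0 < ℓ ≤ 1/M₀`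
(take `M₀ = Λ · exp (max 1 (β₀ / (2 b₀)) / 2)`). -/
theorem stub_offsetMeetsThreshold :
    ∀ Nf : ℕ, Nf = 2 ∨ Nf = 3 → ∀ Λ : ℝ, 0 < Λ → ∀ β₀ : ℝ, ∃ M₀ : ℝ, 0 < M₀ ∧
      ∀ ℓ : ℝ, 0 < ℓ → ℓ ≤ 1 / M₀ → β₀ ≤ afBeta Nf Λ ℓ := by
  intro Nf hNf Λ hΛ β₀
  have hb0 : 0 < betaCoeff₀ Nf := betaCoeff₀_pos_of_two_or_three hNf
  have hb1 : 0 ≤ betaCoeff₁ Nf := betaCoeff₁_nonneg_of_two_or_three hNf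
  set U : ℝ := max 1 (β₀ / (2 * betaCoeff₀ Nf)) with hU
  have hU1 : 1 ≤ U := le_max_left _ _
  have hUβ : β₀ / (2 * betaCoeff₀ Nf) ≤ U := le_max_right _ _
  have hM : 0 < Λ * Real.exp (U / 2) := by positivity
  refine ⟨Λ * Real.exp (U / 2), hM, fun ℓ hℓ hℓM => ?_⟩
  -- from `ℓ ≤ 1 / M₀`: `exp U ≤ 1 / (ℓ² Λ²)`
  have h1 : ℓ * (Λ * Real.exp (U / 2)) ≤ 1 := by rwa [le_div_iff₀ hM] at hℓM
  have h2 : Real.exp U ≤ 1 / (ℓ ^ 2 * Λ ^ 2) := by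
    rw [le_div_iff₀ (by positivity)]
    have h0 : 0 ≤ ℓ * (Λ * Real.exp (U / 2)) := by positivity
    have hsq : (ℓ * (Λ * Real.exp (U / 2))) ^ 2 ≤ 1 := pow_le_one₀ h0 h1
    calc Real.exp U * (ℓ ^ 2 * Λ ^ 2) = (ℓ * (Λ * Real.exp (U / 2))) ^ 2 := by
          rw [show Real.exp U = Real.exp (U / 2) ^ 2 by
            rw [sq, ← Real.exp_add, add_halves]]
          ring
      _ ≤ 1 := hsq
  -- hence `U ≤ u := log (1 / (ℓ² Λ²))` and `log u ≥ 0`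
  have hu : U ≤ Real.log (1 / (ℓ ^ 2 * Λ ^ 2)) := by
    have := Real.log_le_log (Real.exp_pos U) h2
    rwa [Real.log_exp] at this
  have hlog : 0 ≤ Real.log (Real.log (1 / (ℓ ^ 2 * Λ ^ 2))) := Real.log_nonneg (by linarith)
  -- `afBeta = 2 b₀ u + 2 (b₁/b₀) log u ≥ 2 b₀ u ≥ 2 b₀ U ≥ β₀`
  have hA : β₀ ≤ 2 * betaCoeff₀ Nf * U := by
    have := (div_le_iff₀ (by positivity : (0 : ℝ) < 2 * betaCoeff₀ Nf)).1 hUβ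
    linarith
  have hB : 2 * betaCoeff₀ Nf * U ≤ 2 * betaCoeff₀ Nf * Real.log (1 / (ℓ ^ 2 * Λ ^ 2)) :=
    mul_le_mul_of_nonneg_left hu (by positivity)
  have hC : 0 ≤ 2 * (betaCoeff₁ Nf / betaCoeff₀ Nf) * Real.log (Real.log (1 / (ℓ ^ 2 * Λ ^ 2))) := by
    positivity
  unfold afBeta
  linarith

end Summit.QuantumFields.QCD.Cruxes.InterleavedFlowProper.OffsetLastFormatHandover
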